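import Summits.ResolutionOfSingularities.ResolutionOfSingularities.Theorems.SurfacePort
import HarnessLib

/-!
# SurfacePortCells — decomp-res node «SurfacePort» (lens-4 g31, critic row 182 CLEARED DECIDED-MOD-PORT(M+) +1 · MAP
0 now), tree file 2/3 of the node

Content VERBATIM from the decomp-res lens-4 g31 node `HOME/decomp-res-lens-4/g31/SurfacePort.lean` (pin b367c4d1;
imports the landed tree only; the carried
§86 block is the landed `WallCutCells`, dropped); HOME = run/shared/lean/pub/decomp-res; critic row 182 CLEARED
DECIDED-MOD-PORT(M+) +1 · MAP 0 now; landing orders INBOX :896/:909 —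
provenance, critic text and the lens header in full in the first file of the node, `SurfacePort`.  Namespace
`…Theorems.HugValuationCut`; `--supports
stmt-ResolutionOfSingularities-28338`.

## This file

§90 (ENTRANCE CERTIFICATES) kernel-checked chart identities of the finite profiles quoted in the cells' docstrings
(`section SurfaceEntrances`: (y²+x³+u⁵, x⁴)/𝔽₂, z²+x³+y³+w³/𝔽₂, z²+t·x²+u⁷/𝔽₂(t)); §91 (THE CUT) `section
SurfaceCells` minus the h71 corollaries: the g30 located residual
`NoWildWallFreeFreshJumpShallowCompanionKangarooTowers` = the HYPERSURFACE-SURFACE column (DECIDED modulo the port: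
`noTowerWild_surface_of_port` family) ⊓ its complement
**`NoWildNonSurfaceWallFreeFreshJumpShallowCompanionKangarooTowers`** (THE NEW LOCATED RESIDUAL of the lens-4 column
— non-principal root, or a stage of ring dimension ≠ 3, or a stage without rational plane cone outside (prime weight
∧ perfect residues); the route aside's HOME is this file, cone-free), the exact re-location
`noWildWallFreeFreshJumpShallowCompanionKangarooTowers_iff_g31 (h640 : SurfaceChainPort)` and the hypothesis-free
links `…_of_g30` / `…_of_g29` / `…_of_aside`.

[WRITER NOTE (decomp-res writer g11): file split only (tree files ≤ 400 lines); namespace, sections, section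
variables and every declaration exactly as in the
lens (the node's global dupNamespace-linter line is dropped — the library sets it; the `open …Theses` line lives
only in the Theses-cone file; the imports
`HistoryCutCells` / `MaxContactCutSatelliteCut` of the lens are replaced by `WallCutCells` (⊇ both ring-level
chains, cone-free) resp. moved to the cone file).]

(Sources: CossartJannsenSaito2020 Thm. 6.40, Def. 6.38–6.39 pp. 103–104, Thm. 6.35 / Cor. 6.37; Hauser2010Kangaroo;
HauserPerlega2019 §2; Hironaka1964 Ch. III (τ, directrix); Giraud1975; CossartPiltant2008 §2; Matsumura1987;
StacksProject 0804 / 0BIQ.)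
-/

noncomputable section

open CategoryTheory AlgebraicGeometry IsLocalRing TopologicalSpace
open Literature.AlgebraicGeometry.Resolution
open Summit.ResolutionOfSingularities.ResolutionOfSingularities.Theorems
open WeakOrderReduction ForcedTowerClasses DivergentTowerClasses MonomialTowerClasses
open HugDimensionClasses HugDimensionKernels SurfaceShadowClasses SurfaceShadowKernels
open NearPointCut (SingularClass)
open Scheme.IdealSheafData (vanishingIdeal)
open scoped BigOperators

namespace Summit.ResolutionOfSingularities.ResolutionOfSingularities.Theorems.HugValuationCut

section SurfaceEntrances

variable {R : Type*} [CommRing R]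

/-! ## §90 (g31 · ENTRANCE CERTIFICATES) kernel-checked chart identities of the finite profiles quoted in the cells' docstrings
(standard monomial substitutions of the point blow-up; identities over every commutative ring). -/

/-- (R′1) the NON-PRINCIPAL weight-2 `2`-power profile `𝓘 = (y² + x³ + u⁵, x⁴)` — `u`-chart `x ↦ xu, y ↦ yu`: the
total transforms are
`u²·(y² + x³u + u³)` and `u²·(x⁴u²)`, so the weight-2 controlled transform is `(y² + x³u + u³, x⁴u²)` (again
non-principal, again a
`2`-power form of order 2 at the origin). [folklore] -/
theorem surface_entrance_nonprincipal_chart (x y u : R) :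
    (y * u) ^ 2 + (x * u) ^ 3 + u ^ 5 = u ^ 2 * (y ^ 2 + x ^ 3 * u + u ^ 3) ∧ (x * u) ^ 4 = u ^ 2 * (x ^ 4 * u ^ 2) := by
  constructor <;> ring

/-- (R′2) the RING-DIMENSION-4 profile `z² + x³ + y³ + w³` in `𝔸⁴` — `x`-chart `z ↦ zx, y ↦ yx, w ↦ wx`: total transform
`x²·(z² + x·(1 + y³ + w³))`. [folklore] -/
theorem surface_entrance_fourfold_chart (x y z w : R) :
    (z * x) ^ 2 + x ^ 3 + (y * x) ^ 3 + (w * x) ^ 3 = x ^ 2 * (z ^ 2 + x * (1 + y ^ 3 + w ^ 3)) := by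
  ring

/-- (E1) the E8-type census profile `y² + x³ + u⁵` (T-history f608fd95 row «2:E8iso:y2+x3+u5», word `u x u u`) —
`u`-chart then `x`-chart:
`u²·(y² + x³u + u³)` and `x²·(y² + x·u·(x + u²))`; at every stage the initial form is `y²`, the square of the
REGULAR PARAMETER `y`
(plane cone), and the stalk ideal is principal. [folklore] -/
theorem surface_entrance_E8_charts (x y u : R) :
    (y * u) ^ 2 + (x * u) ^ 3 + u ^ 5 = u ^ 2 * (y ^ 2 + x ^ 3 * u + u ^ 3) ∧
      (y * x) ^ 2 + x ^ 3 * (u * x) + (u * x) ^ 3 = x ^ 2 * (y ^ 2 + x * u * (x + u ^ 2)) := by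
  constructor <;> ring

end SurfaceEntrances

section SurfaceCells

/-! ## §91 (g31 · THE CUT) the g30 located residual = the HYPERSURFACE-SURFACE column (DECIDED modulo the port
`SurfaceChainPort`,
bridge §89) ∧ the NON-SURFACE residual (UNDECIDED), exact by `noTowerWild_split`; re-locations by name down the aside chain. -/

/-- **CELL (g30 residual ∧ SURFACE COLUMN)** — DECIDED MODULO THE PORT `SurfaceChainPort` (CJS 2020 Thm. 6.40): wild, off-locus
singular class, `p`-power form at every marked point, kangaroo-recurrent, companion-recurrent, shallow,
fresh-jumping at prime weight,
wall-free at weight 2, AND: hypersurface root (`𝓘_{0,x_0}` principal), ring dimension exactly 3 at every marked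
point, plane cone
(`in_n = c·Z^n`, `Z` a rational regular parameter) at every marked point — the last TYPED (`PlaneConeTower`) or in
its AUTOMATIC form
«`n` prime and perfect residue fields at the marked points» (`PerfectResidueTower`; §88 then PROVES the plane cone
from the class letter
`PPowerTower n`).  By the bridge `noTower_surfaceColumn_of_port` such a tower is an infinite chain of length-one
fundamental units at
isolated points of an excellent two-dimensional hypersurface, which Thm. 6.40 forbids.  ENTRANCES (every letter of
the column OCCURS; the class letters of earlier nodes are quoted from their census rows):
(E1) `p = 2`, PERFECT ground field: EVERY census bed of HOME/census/it/history T-history f608fd95 and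
HOME/census/it/walls T-walls
531ba93e is a HYPERSURFACE in a threefold over the PERFECT field `𝔽₂` with PRIME weight `2 = p` (residue fields of
closed points of a
finite-type `𝔽₂`-scheme are finite, hence perfect: `PerfectResidueTower`), hence in this column at every stage it
visits — plane cone is
AUTOMATIC there (`planeConeAt_of_pPowerFormAt_perfect`: over a perfect residue field a weight-`p` `p`-power form of order `p` is
`Z^p + (higher)`), e.g. «2:E8iso:y2+x3+u5» `y² + x³ + u⁵ →(u) y² + x³u + u³ →(x) y² + xu(x + u²)` (`surface_entrance_E8_charts`,
initial form `y²` throughout); (E2) `p ≥ 3`: NODE-g29's char-5 chain `z⁵ + x⁴(y³ − x²)² + x⁷y²` (four fresh jumps, shade 2) —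
principal, threefold, initial form `z⁵` = plane cone at every listed stage; the `p = 3` beds of T-walls (weight 3,
`z³ + …`) likewise.
So, GIVEN the port, EVERY recorded profile of the wild column lies in a decided cell. -/
def WildSurfaceWallFreeFreshJumpShallowCompanionKangarooTowersTerminate (n : ℕ) : Prop :=
  NoTowerWild n fun T =>
    (((((((SingularClass T ∧ Nonempty (MarkedShadow T n)) ∧ PPowerTower n T) ∧ ¬ EventuallyJumpFree n T) ∧
      ¬ EventuallyCompanionJumpFree n T) ∧ ¬ DeepTower n T) ∧ ¬ (n.Prime ∧ OldComponentJumpTower n T)) ∧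
      ¬ (n = 2 ∧ WalledTower T)) ∧ SurfaceColumn n T

/-- **CELL (g30 residual ∧ ¬ SURFACE COLUMN) · THE LOCATED RESIDUAL after g31** — UNDECIDED · IDEA-NEEDED: wild,
off-locus singular
class, `p`-power form at every marked point, kangaroo-recurrent, companion-recurrent, shallow, fresh-jumping at
prime weight, wall-free
at weight 2, and NOT in the hypersurface-surface column: the root stalk ideal is NOT PRINCIPAL, or some marked point has ring
dimension `≠ 3` (i.e. `≥ 4`: `DimThreeAt` fails only below 3, where the class is empty by the surface nodes), or (at
some marked point
the tangent cone is NOT an `n`-fold rational plane) ∧ ¬(`n` prime ∧ perfect residue fields at the marked points) —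
i.e. `e ≤ 1` at
COMPOSITE weight (`in_n = (xu)²·…`) or over an IMPERFECT residue field (`z² + t·x²`).  ENTRANCES (single-stage
profiles carrying the negated letter together with the
stage letters of the class; no recorded census bed lies here — (E1) above): (R′1) NON-PRINCIPAL, `p = 2`, rd 3: `𝓘 =
(y² + x³ + u⁵, x⁴)`
over `𝔽₂` — a `2`-power form of order 2 (`y²`, `x⁴ ∈ 𝔪³`), support `{ord ≥ 2} = Sing₂(y² + x³ + u⁵) ∩ V(x) = {0}` isolated, not
principal (two coprime generators), `u`-chart controlled transform `(y² + x³u + u³, x⁴u²)`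
(`surface_entrance_nonprincipal_chart`)
again non-principal of order 2; (R′2) RING DIMENSION 4, `p = 2`: `z² + x³ + y³ + w³ ∈ 𝔽₂[x,y,z,w]` — isolated singular point
(partials `x², y², w²`), `2`-power form `z²`, principal, plane cone, but `DimFourAt` at stage 0; `x`-chart `z² + x(1 + y³ + w³)`
(`surface_entrance_fourfold_chart`); (R′3) NO PLANE CONE, rd 3, principal: `z² + t·x² + u⁷` over the IMPERFECT field `𝔽₂(t)`
(`in₂ = Z² + tX²` is a `2`-power form, irreducible over `κ`: `e = 1 < ē = 2`) and, at composite weight `n = 4`, `x²u² + z⁵ + …`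
(`in₄ = (XU)²`, `e = 1` even over `k̄`) — the `e ≤ 1` sub-column, where Cor. 6.37 (tree port `CJS2020_noInfiniteNearChain_eOne`)
is the printed law (NEXT-g32). -/
def WildNonSurfaceWallFreeFreshJumpShallowCompanionKangarooTowersTerminate (n : ℕ) : Prop :=
  NoTowerWild n fun T =>
    (((((((SingularClass T ∧ Nonempty (MarkedShadow T n)) ∧ PPowerTower n T) ∧ ¬ EventuallyJumpFree n T) ∧
      ¬ EventuallyCompanionJumpFree n T) ∧ ¬ DeepTower n T) ∧ ¬ (n.Prime ∧ OldComponentJumpTower n T)) ∧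
      ¬ (n = 2 ∧ WalledTower T)) ∧ ¬ SurfaceColumn n T

/-- **KERNEL (pure logic): every class splits EXACTLY by the surface column.** [folklore] -/
theorem noTowerWild_split_surface {n : ℕ} (P : ForcedTower → Prop) :
    NoTowerWild n P ↔ NoTowerWild n (fun T => P T ∧ SurfaceColumn n T) ∧ NoTowerWild n (fun T => P T ∧ ¬ SurfaceColumn n T) :=
  noTowerWild_split _ _

/-- **DECIDED MODULO THE PORT (KERNEL bridge, every `n ≥ 1`, every field): THE SURFACE CELL IS EMPTY.** [folklore] -/
theorem wildSurfaceWallFree_of_port (h640 : SurfaceChainPort) {n : ℕ} (hn : 1 ≤ n) :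
    WildSurfaceWallFreeFreshJumpShallowCompanionKangarooTowersTerminate n :=
  noTowerWild_surfaceColumn_of_port h640 hn _

/-- **EXACT (pure logic): the g30 located residual = the surface cell ∧ the non-surface residual.** [folklore] -/
theorem wildWallFreeFreshJumpShallow_split_g31 (n : ℕ) :
    WildWallFreeFreshJumpShallowCompanionKangarooTowersTerminate n ↔
      WildSurfaceWallFreeFreshJumpShallowCompanionKangarooTowersTerminate n ∧
        WildNonSurfaceWallFreeFreshJumpShallowCompanionKangarooTowersTerminate n :=
  noTowerWild_split _ _

/-- **EXACT RE-LOCATION GIVEN THE PORT: the g30 located residual ⟺ THE NON-SURFACE RESIDUAL** (`n ≥ 1`). [folklore] -/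
theorem wildWallFreeFreshJumpShallow_iff_g31 (h640 : SurfaceChainPort) {n : ℕ} (hn : 1 ≤ n) :
    WildWallFreeFreshJumpShallowCompanionKangarooTowersTerminate n ↔
      WildNonSurfaceWallFreeFreshJumpShallowCompanionKangarooTowersTerminate n :=
  ⟨fun h => ((wildWallFreeFreshJumpShallow_split_g31 n).mp h).2,
    fun h => (wildWallFreeFreshJumpShallow_split_g31 n).mpr ⟨wildSurfaceWallFree_of_port h640 hn, h⟩⟩

/-- BY NAME: **no wild tower in the hypersurface-surface column** (DECIDED modulo `SurfaceChainPort`). -/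
def NoWildSurfaceTowers : Prop :=
  ∀ n : ℕ, 1 ≤ n → WildSurfaceWallFreeFreshJumpShallowCompanionKangarooTowersTerminate n

/-- BY NAME: **no wild NON-SURFACE wall-free fresh-jumping shallow companion-recurrent tower** — THE LOCATED
RESIDUAL of the aside chain
`NoWildContactFreeOffLocusTowers ⊇ … ⊇ NoWildWallFreeFreshJumpShallowCompanionKangarooTowers ⊇ ·` after g31. -/
def NoWildNonSurfaceWallFreeFreshJumpShallowCompanionKangarooTowers : Prop :=
  ∀ n : ℕ, 1 ≤ n → WildNonSurfaceWallFreeFreshJumpShallowCompanionKangarooTowersTerminate n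

/-- **DECIDED BY NAME MODULO THE PORT.** [folklore] -/
theorem noWildSurfaceTowers_of_port (h640 : SurfaceChainPort) : NoWildSurfaceTowers := fun _ hn =>
  wildSurfaceWallFree_of_port h640 hn

/-- **EXACT BY NAME as a conjunction (surface ∧ non-surface), HYPOTHESIS-FREE.** [folklore] -/
theorem noWildWallFreeFreshJumpShallowCompanionKangarooTowers_iff_surface_and_nonSurface :
    NoWildWallFreeFreshJumpShallowCompanionKangarooTowers ↔
      NoWildSurfaceTowers ∧ NoWildNonSurfaceWallFreeFreshJumpShallowCompanionKangarooTowers :=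
  ⟨fun h => ⟨fun n hn => ((wildWallFreeFreshJumpShallow_split_g31 n).mp (h n hn)).1,
      fun n hn => ((wildWallFreeFreshJumpShallow_split_g31 n).mp (h n hn)).2⟩,
    fun h n hn => (wildWallFreeFreshJumpShallow_split_g31 n).mpr ⟨h.1 n hn, h.2 n hn⟩⟩

/-- **EXACT RE-LOCATION BY NAME GIVEN THE PORT: THE TARGET (g30 residual) ⟺ THE NON-SURFACE RESIDUAL.** [folklore] -/
theorem noWildWallFreeFreshJumpShallowCompanionKangarooTowers_iff_g31 (h640 : SurfaceChainPort) :
    NoWildWallFreeFreshJumpShallowCompanionKangarooTowers ↔ NoWildNonSurfaceWallFreeFreshJumpShallowCompanionKangarooTowers :=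
  ⟨fun h n hn => (wildWallFreeFreshJumpShallow_iff_g31 h640 hn).mp (h n hn),
    fun h n hn => (wildWallFreeFreshJumpShallow_iff_g31 h640 hn).mpr (h n hn)⟩

/-- **GIVEN THE PORT: the g29 residual ⟺ the non-surface residual.** [folklore] -/
theorem noWildFreshJumpShallowCompanionKangarooTowers_iff_g31 (h640 : SurfaceChainPort) :
    NoWildFreshJumpShallowCompanionKangarooTowers ↔ NoWildNonSurfaceWallFreeFreshJumpShallowCompanionKangarooTowers :=
  noWildFreshJumpShallowCompanionKangarooTowers_iff_g30.trans (noWildWallFreeFreshJumpShallowCompanionKangarooTowers_iff_g31 h640)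

/-- **GIVEN THE PORT: the g28 residual ⟺ the non-surface residual.** [folklore] -/
theorem noWildFreeJumpShallowCompanionKangarooTowers_iff_g31 (h640 : SurfaceChainPort) :
    NoWildFreeJumpShallowCompanionKangarooTowers ↔ NoWildNonSurfaceWallFreeFreshJumpShallowCompanionKangarooTowers :=
  noWildFreeJumpShallowCompanionKangarooTowers_iff_g30.trans (noWildWallFreeFreshJumpShallowCompanionKangarooTowers_iff_g31 h640)

/-- **GIVEN THE PORT: the g27 residual ⟺ the non-surface residual.** [folklore] -/
theorem noWildShallowCompanionKangarooTowers_iff_g31 (h640 : SurfaceChainPort) :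
    NoWildShallowCompanionKangarooTowers ↔ NoWildNonSurfaceWallFreeFreshJumpShallowCompanionKangarooTowers :=
  noWildShallowCompanionKangarooTowers_iff_g30.trans (noWildWallFreeFreshJumpShallowCompanionKangarooTowers_iff_g31 h640)

/-- **GIVEN THE PORT: the g26 residual ⟺ the non-surface residual.** [folklore] -/
theorem noWildCompanionKangarooTowers_iff_g31 (h640 : SurfaceChainPort) :
    NoWildCompanionKangarooTowers ↔ NoWildNonSurfaceWallFreeFreshJumpShallowCompanionKangarooTowers :=
  noWildCompanionKangarooTowers_iff_g30.trans (noWildWallFreeFreshJumpShallowCompanionKangarooTowers_iff_g31 h640)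

/-- up-link (hypothesis-free): the g31 residual ⟸ the g30 residual (THE TARGET). [folklore] -/
theorem noWildNonSurfaceWallFreeFreshJumpShallowCompanionKangarooTowers_of_g30
    (h : NoWildWallFreeFreshJumpShallowCompanionKangarooTowers) :
    NoWildNonSurfaceWallFreeFreshJumpShallowCompanionKangarooTowers :=
  (noWildWallFreeFreshJumpShallowCompanionKangarooTowers_iff_surface_and_nonSurface.mp h).2

/-- up-link (hypothesis-free): the g31 residual ⟸ the g29 residual. [folklore] -/
theorem noWildNonSurfaceWallFreeFreshJumpShallowCompanionKangarooTowers_of_g29 (h : NoWildFreshJumpShallowCompanionKangarooTowers) :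
    NoWildNonSurfaceWallFreeFreshJumpShallowCompanionKangarooTowers :=
  noWildNonSurfaceWallFreeFreshJumpShallowCompanionKangarooTowers_of_g30 (noWildWallFreeFreshJumpShallowCompanionKangarooTowers_of_g29 h)

/-- up-link from the TREE aside `NoWildContactFreeOffLocusTowers` (hypothesis-free). [folklore] -/
theorem noWildNonSurfaceWallFreeFreshJumpShallowCompanionKangarooTowers_of_aside (h : NoWildContactFreeOffLocusTowers) :
    NoWildNonSurfaceWallFreeFreshJumpShallowCompanionKangarooTowers :=
  noWildNonSurfaceWallFreeFreshJumpShallowCompanionKangarooTowers_of_g30 (noWildWallFreeFreshJumpShallowCompanionKangarooTowers_of_aside h)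

/-- **THE SURFACE COLUMN OF THE WHOLE TREE ASIDE, GIVEN THE PORT** (class-generic bridge applied to 28338's own
binder: the cut does
not depend on the intermediate nodes). [folklore] -/
theorem noTowerWild_contactFreeOffLocus_surface_of_port (h640 : SurfaceChainPort) {n : ℕ} (hn : 1 ≤ n)
    (P : ForcedTower → Prop) : NoTowerWild n fun T => P T ∧ SurfaceColumn n T :=
  noTowerWild_surfaceColumn_of_port h640 hn P

end SurfaceCells

end Summit.ResolutionOfSingularities.ResolutionOfSingularities.Theorems.HugValuationCut
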